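import Mathlib
import Summits.NavierStokesRegularity.NavierStokesRegularity.Theorems.ThreadingFluxHorizonTowerDefs
import Summits.NavierStokesRegularity.NavierStokesRegularity.Theorems.ThreadingFluxHorizonTowerSphereRigidity
import Summits.NavierStokesRegularity.NavierStokesRegularity.Theorems.ThreadingFluxHorizonTowerProfileFormulas
import HarnessLib

/-!
# Crux `PoloidalLiouville` (stmt-NavierStokesRegularity-1222, W1), crux idea «horizon-threading-tower» (ns-idea-15):
# the ORDER-ONE HORIZON LAW = STEADY EULER ON THE SPHERE, `HorizonTower.OrderOneSphereEuler`, in the kernel, BY NAME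

Support file (`--supports stmt-NavierStokesRegularity-1222`, helper), second of two (the first is
`ThreadingFluxHorizonTowerSphereRigidity`).  Experiment cell `ns-wall-extremal`, width hand ns-wall-eng-4 g3.  0 kit.

## Statement (`Theorems/ThreadingFluxHorizonTowerDefs.lean` l.144, planner label (M, engine E3b), VERBATIM by name)

For `U` smooth off `x₀`, degree-0 homogeneous about `x₀`, divergence free and unthreaded off `x₀`, with radial part
`f = ⟪U, y⟫/r` and tangential potential `Φ` (smooth and degree-0 homogeneous off `x₀`, `r²ΔΦ = −2f`):
`𝔏₁[U](x) = −r ⟪y, ∇f × ∇Φ⟫` for every `x ≠ x₀` (`y = x − x₀`, `r = ‖y‖`, `𝔏₁ = horizonL1`).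

## Proof

1. `SphereEuler.profile_eq` — the statement does NOT hand us `U = f ξ + r∇Φ`; it is FORCED: the difference
   `V = U − (f/r) y − r ∇Φ` is `C²` off the origin, degree-0 homogeneous, tangential (Euler `⟪∇Φ, y⟫ = 0`), divergence free
   (`div((f/r) y) = 2f/r` by Euler for the degree-(−1) function `f/r`, `div(r∇Φ) = rΔΦ = −2f/r`) and radially irrotational
   (`curl((f/r) y) = ∇(f/r) × y`, `curl(r∇Φ) = ∇r × ∇Φ = (y × ∇Φ)/r`), hence `V ≡ 0` by the sphere rigidity lemma
   `SphereRigidity.eq_zero` (file 1).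
2. `SphereEuler.horizonL1_origin` — `⟪y, curl(U × Ω)⟫ = ⟪DU[Ω], y⟫ + ⟪U, Ω⟫ = ⟪Ω, ∇(r f)⟫ = r ⟪Ω, ∇f⟫`
   (`inner_curl_cross_of_tangent`, `inner_gradient_inner_sub` of `…HorizonTowerFirstLemmas`), and
   `Ω = curl U = (∇f × y)/r + f β (y × y) + (y × ∇Φ)/r` from step 1, so `⟪Ω, ∇f⟫ = −⟪y, ∇f × ∇Φ⟫/r`.
3. `orderOneSphereEuler` — translation `y ↦ x₀ + y` (`fderiv_comp_add_left`, `iteratedFDeriv_comp_add_left`).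

HONEST FRAME: kinematics / elliptic rigidity about hypothetical scale-free profiles (information-grade: it identifies the vanishing
of the order-ONE horizon law with `{Δ_S Φ, Φ}`-type stationarity on `S²`, the framing of `HorizonTowerZonality`); the laws
`OrderTwoHorizonLaw(Blowdown)` are untouched; `PoloidalLiouville` (1222) and NS regularity stay OPEN.

## References
* planner ns-idea-15, `Cruxes/PoloidalLiouville/HorizonTowerSketch.lean` (`OrderOneSphereEuler`).
* A. J. Majda, A. L. Bertozzi, *Vorticity and Incompressible Flow* (CUP 2002), §1.1 (vector identities). [MajdaBertozziCUP2002]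
-/

-- the summit and its single problem share the name (D-0017 nested layout)
set_option linter.dupNamespace false

noncomputable section

namespace Summit.NavierStokesRegularity.NavierStokesRegularity.Theorems.PoloidalLiouville.HorizonTower

open Set Function Filter Topology Metric
open scoped Topology RealInnerProductSpace Laplacian ContDiff
open Literature.Analysis.FluidPDE

/-! ## The order-one horizon law at the origin -/

namespace SphereEuler

/-- Radial gradients: `∇(h(‖·‖²))` is a multiple of the position vector. Instance `‖·‖`:
`∇‖·‖(x) = ‖x‖⁻¹ • x` off the origin. -/
theorem gradient_norm {x : E3} (hx : x ≠ 0) : gradient (fun w : E3 => ‖w‖) x = ‖x‖⁻¹ • x := by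
  have hq : (‖x‖ ^ 2) ≠ 0 := by positivity
  have h := gradient_comp_norm_sq (z := x) (Real.hasDerivAt_sqrt hq)
  have e : (fun w : E3 => Real.sqrt (‖w‖ ^ 2)) = fun w => ‖w‖ := funext fun w => Real.sqrt_sq (norm_nonneg w)
  rw [e, Real.sqrt_sq (norm_nonneg x)] at h
  rw [h]
  congr 1
  field_simp

/-- `∇(‖·‖⁻¹)(x)` is a multiple of `x` off the origin. -/
theorem gradient_norm_inv_radial {x : E3} (hx : x ≠ 0) :
    ∃ β : ℝ, gradient (fun w : E3 => ‖w‖⁻¹) x = β • x := by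
  have hq : (‖x‖ ^ 2) ≠ 0 := by positivity
  have hs : Real.sqrt (‖x‖ ^ 2) ≠ 0 := by rw [Real.sqrt_sq (norm_nonneg x)]; exact norm_ne_zero_iff.mpr hx
  have hd : HasDerivAt (fun s : ℝ => (Real.sqrt s)⁻¹) (-(1 / (2 * Real.sqrt (‖x‖ ^ 2))) / Real.sqrt (‖x‖ ^ 2) ^ 2)
      (‖x‖ ^ 2) := (Real.hasDerivAt_sqrt hq).inv hs
  have h := gradient_comp_norm_sq (g := fun s : ℝ => (Real.sqrt s)⁻¹) (z := x) hd
  have e : (fun w : E3 => (fun s : ℝ => (Real.sqrt s)⁻¹) (‖w‖ ^ 2)) = fun w => ‖w‖⁻¹ :=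
    funext fun w => by simp only [Real.sqrt_sq (norm_nonneg w)]
  rw [e] at h
  exact ⟨_, h⟩

/-- `‖·‖` is differentiable off the origin. -/
theorem differentiableAt_norm' {x : E3} (hx : x ≠ 0) : DifferentiableAt ℝ (fun w : E3 => ‖w‖) x :=
  (contDiffAt_norm ℝ hx (n := 1)).differentiableAt (by simp)

/-- `D‖·‖(x)[v] = ‖x‖⁻¹ ⟪x, v⟫` off the origin. -/
theorem fderiv_norm_apply {x : E3} (hx : x ≠ 0) (v : E3) :
    fderiv ℝ (fun w : E3 => ‖w‖) x v = ‖x‖⁻¹ * inner ℝ x v := by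
  rw [← Literature.Analysis.FluidPDE.inner_gradient_left, gradient_norm hx, real_inner_smul_left]

/-- If `φ(c z) = φ(z)` for `z` near `y`, `c ≠ 0`, and `φ` is differentiable at `y` and at `c y`, then
`∇φ(c y) = c⁻¹ ∇φ(y)` (scalar version of `fderiv_smul_of_zeroHomogeneous`). -/
theorem gradient_smul_of_zeroHomogeneous {φ : E3 → ℝ} {y : E3} {c : ℝ} (hc : c ≠ 0)
    (hy : DifferentiableAt ℝ φ y) (hcy : DifferentiableAt ℝ φ (c • y))
    (hhom : ∀ᶠ z in 𝓝 y, φ (c • z) = φ z) :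
    gradient φ (c • y) = c⁻¹ • gradient φ y := by
  have hL : HasFDerivAt (fun z : E3 => c • z) (c • ContinuousLinearMap.id ℝ E3) y :=
    (hasFDerivAt_id y).const_smul c
  have h1 : HasFDerivAt (fun z => φ (c • z)) ((fderiv ℝ φ (c • y)).comp (c • ContinuousLinearMap.id ℝ E3)) y :=
    hcy.hasFDerivAt.comp y hL
  have h2 : HasFDerivAt (fun z => φ (c • z)) (fderiv ℝ φ y) y :=
    hy.hasFDerivAt.congr_of_eventuallyEq hhom
  have h3 : (fderiv ℝ φ (c • y)).comp (c • ContinuousLinearMap.id ℝ E3) = fderiv ℝ φ y := h1.unique h2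
  have h4 : c • fderiv ℝ φ (c • y) = fderiv ℝ φ y := by
    rw [← h3]; ext v; simp
  rw [gradient, gradient, ← h4, map_smul, smul_smul, inv_mul_cancel₀ hc, one_smul]

variable {U : E3 → E3} {f Φ : E3 → ℝ}

/-- **The decomposition `U = (f/r) y + r ∇Φ` off the origin** of a smooth, degree-0 homogeneous, divergence-free,
unthreaded profile `U` with radial part `f` and tangential potential `Φ` (`r²ΔΦ = −2f`): the difference
`V = U − (f/r) y − r∇Φ` satisfies the hypotheses of the sphere rigidity lemma, hence vanishes. -/
theorem profile_eq (hU : ContDiffOn ℝ (⊤ : ℕ∞) U {0}ᶜ) (hΦ : ContDiffOn ℝ (⊤ : ℕ∞) Φ {0}ᶜ)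
    (hUhom : ∀ c : ℝ, 0 < c → ∀ y : E3, U (c • y) = U y) (hΦhom : ∀ c : ℝ, 0 < c → ∀ y : E3, Φ (c • y) = Φ y)
    (hdiv : ∀ x : E3, x ≠ 0 → VectorCalculus.divergence U x = 0)
    (hrot : ∀ x : E3, x ≠ 0 → inner ℝ (curl U x) x = 0)
    (hf : ∀ x : E3, x ≠ 0 → f x = inner ℝ (U x) x / ‖x‖)
    (hP : ∀ x : E3, x ≠ 0 → ‖x‖ ^ 2 * (Δ Φ) x = -2 * f x) {x : E3} (hx : x ≠ 0) :
    U x = (f x * ‖x‖⁻¹) • x + ‖x‖ • gradient Φ x := by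
  have hopen : IsOpen ({0}ᶜ : Set E3) := isOpen_compl_singleton
  -- smoothness off the origin
  have hnormC : ContDiffOn ℝ (⊤ : ℕ∞) (fun w : E3 => ‖w‖) {0}ᶜ := fun z hz =>
    (contDiffAt_norm ℝ (show z ≠ 0 from hz)).contDiffWithinAt
  have hfC : ContDiffOn ℝ (⊤ : ℕ∞) f {0}ᶜ :=
    ((hU.inner ℝ contDiffOn_id).div hnormC fun z hz => norm_ne_zero_iff.mpr hz).congr fun z hz => hf z hz
  have hgC : ContDiffOn ℝ (⊤ : ℕ∞) (fun w : E3 => f w * ‖w‖⁻¹) {0}ᶜ :=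
    hfC.mul (hnormC.inv fun z hz => norm_ne_zero_iff.mpr hz)
  have hgradΦC : ContDiffOn ℝ (⊤ : ℕ∞) (gradient Φ) {0}ᶜ :=
    (InnerProductSpace.toDual ℝ E3).symm.contDiff.comp_contDiffOn (hΦ.fderiv_of_isOpen hopen (by norm_cast))
  set P : E3 → E3 := fun w => (f w * ‖w‖⁻¹) • w + ‖w‖ • gradient Φ w with hPdef
  have hPC : ContDiffOn ℝ (⊤ : ℕ∞) P {0}ᶜ := (hgC.smul contDiffOn_id).add (hnormC.smul hgradΦC)
  set V : E3 → E3 := fun w => U w - P w with hVdef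
  have hVC : ContDiffOn ℝ 2 V {0}ᶜ := (hU.sub hPC).of_le (by norm_cast)
  -- pointwise regularity off the origin
  have hUd : ∀ z : E3, z ≠ 0 → DifferentiableAt ℝ U z := fun z hz =>
    ((hU z hz).contDiffAt (hopen.mem_nhds hz)).differentiableAt (by simp)
  have hΦ2 : ∀ z : E3, z ≠ 0 → ContDiffAt ℝ 2 Φ z := fun z hz =>
    ((hΦ z hz).contDiffAt (hopen.mem_nhds hz)).of_le (by norm_cast)
  have hΦd : ∀ z : E3, z ≠ 0 → DifferentiableAt ℝ Φ z := fun z hz => (hΦ2 z hz).differentiableAt (by simp)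
  have hfd : ∀ z : E3, z ≠ 0 → DifferentiableAt ℝ f z := fun z hz =>
    ((hfC z hz).contDiffAt (hopen.mem_nhds hz)).differentiableAt (by simp)
  have hgd : ∀ z : E3, z ≠ 0 → DifferentiableAt ℝ (fun w : E3 => f w * ‖w‖⁻¹) z := fun z hz =>
    ((hgC z hz).contDiffAt (hopen.mem_nhds hz)).differentiableAt (by simp)
  have hgradΦd : ∀ z : E3, z ≠ 0 → DifferentiableAt ℝ (gradient Φ) z := fun z hz =>
    ((hgradΦC z hz).contDiffAt (hopen.mem_nhds hz)).differentiableAt (by simp)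
  -- homogeneity of the ingredients
  have hfhom : ∀ c : ℝ, 0 < c → ∀ y : E3, f (c • y) = f y := by
    intro c hc y
    by_cases hy : y = 0
    · rw [hy, smul_zero]
    · have hcy : c • y ≠ 0 := smul_ne_zero hc.ne' hy
      rw [hf _ hcy, hf _ hy, hUhom c hc y, inner_smul_right, norm_smul, Real.norm_of_nonneg hc.le]
      field_simp
  have hgradΦhom : ∀ c : ℝ, 0 < c → ∀ y : E3, y ≠ 0 → gradient Φ (c • y) = c⁻¹ • gradient Φ y := by
    intro c hc y hy
    exact gradient_smul_of_zeroHomogeneous hc.ne' (hΦd y hy) (hΦd _ (smul_ne_zero hc.ne' hy))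
      (Eventually.of_forall fun z => hΦhom c hc z)
  -- Euler identities
  have hEulerΦ : ∀ z : E3, z ≠ 0 → inner ℝ (gradient Φ z) z = 0 := by
    intro z hz
    have hev : ∀ᶠ c in 𝓝 (1 : ℝ), Φ (c • z) = (fun _ : ℝ => (1 : ℝ)) c • Φ z := by
      filter_upwards [Ioi_mem_nhds (zero_lt_one' ℝ)] with c hc
      rw [hΦhom c hc z, one_smul]
    have h := PoloidalField.fderiv_apply_self_of_homogeneous (a := fun _ : ℝ => (1 : ℝ)) (a' := 0) (hΦd z hz)
      (hasDerivAt_const (1 : ℝ) (1 : ℝ)) hev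
    rw [Literature.Analysis.FluidPDE.inner_gradient_left, h, zero_smul]
  have hEulerg : ∀ z : E3, z ≠ 0 → fderiv ℝ (fun w : E3 => f w * ‖w‖⁻¹) z z = -(f z * ‖z‖⁻¹) := by
    intro z hz
    have hev : ∀ᶠ c in 𝓝 (1 : ℝ), (fun w : E3 => f w * ‖w‖⁻¹) (c • z) = (fun c : ℝ => c⁻¹) c • (f z * ‖z‖⁻¹) := by
      filter_upwards [Ioi_mem_nhds (zero_lt_one' ℝ)] with c hc
      simp only [hfhom c hc z, norm_smul, Real.norm_of_nonneg hc.le, mul_inv, smul_eq_mul]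
      ring
    have ha : HasDerivAt (fun c : ℝ => c⁻¹) (-1 : ℝ) 1 := by
      simpa using (hasDerivAt_inv (one_ne_zero' ℝ))
    have h := PoloidalField.fderiv_apply_self_of_homogeneous (a := fun c : ℝ => c⁻¹) (a' := -1) (hgd z hz) ha hev
    rw [h, smul_eq_mul, neg_one_mul]
  -- (1) homogeneity of V
  have hVhom : ∀ c : ℝ, 0 < c → ∀ y : E3, V (c • y) = V y := by
    intro c hc y
    by_cases hy : y = 0
    · rw [hy, smul_zero]
    · have e1 : f y * (c * ‖y‖)⁻¹ * c = f y * ‖y‖⁻¹ := by field_simp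
      have e2 : c * ‖y‖ * c⁻¹ = ‖y‖ := by field_simp
      show U (c • y) - ((f (c • y) * ‖c • y‖⁻¹) • (c • y) + ‖c • y‖ • gradient Φ (c • y))
        = U y - ((f y * ‖y‖⁻¹) • y + ‖y‖ • gradient Φ y)
      rw [hUhom c hc y, hfhom c hc y, hgradΦhom c hc y hy, norm_smul, Real.norm_of_nonneg hc.le, smul_smul,
        smul_smul, e1, e2]
  -- (2) tangency of V
  have hVtan : ∀ z : E3, inner ℝ (V z) z = 0 := by
    intro z
    by_cases hz : z = 0
    · rw [hz, inner_zero_right]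
    · have hUz : inner ℝ (U z) z = f z * ‖z‖ := by
        rw [hf z hz, div_mul_cancel₀ _ (norm_ne_zero_iff.mpr hz)]
      simp only [hVdef, hPdef, inner_sub_left, inner_add_left, real_inner_smul_left, hUz, hEulerΦ z hz,
        real_inner_self_eq_norm_sq, mul_zero, add_zero]
      field_simp
      ring
  -- (3) V is divergence free off the origin
  have hVdiv : ∀ z : E3, z ≠ 0 → VectorCalculus.divergence V z = 0 := by
    intro z hz
    have hnz : ‖z‖ ≠ 0 := norm_ne_zero_iff.mpr hz
    have hd1 : DifferentiableAt ℝ (fun w : E3 => (f w * ‖w‖⁻¹) • w) z := (hgd z hz).smul differentiableAt_id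
    have hd2 : DifferentiableAt ℝ (fun w : E3 => ‖w‖ • gradient Φ w) z :=
      (differentiableAt_norm' hz).smul (hgradΦd z hz)
    have hdivsub : VectorCalculus.divergence V z = VectorCalculus.divergence U z
        - (VectorCalculus.divergence (fun w : E3 => (f w * ‖w‖⁻¹) • w) z
          + VectorCalculus.divergence (fun w : E3 => ‖w‖ • gradient Φ w) z) := by
      simp only [VectorCalculus.divergence, hVdef, hPdef]
      rw [fderiv_fun_sub (hUd z hz) (hd1.fun_add hd2), fderiv_fun_add hd1 hd2, ContinuousLinearMap.toLinearMap_sub,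
        ContinuousLinearMap.toLinearMap_add, map_sub, map_add]
    have hdivA : VectorCalculus.divergence (fun w : E3 => (f w * ‖w‖⁻¹) • w) z = 2 * (f z * ‖z‖⁻¹) := by
      rw [divergence_smul_apply (u := fun w : E3 => w) (hgd z hz) differentiableAt_id, hEulerg z hz,
        Sverak2011.divergence_id_three]
      ring
    have hdivB : VectorCalculus.divergence (fun w : E3 => ‖w‖ • gradient Φ w) z = ‖z‖ * (Δ Φ) z := by
      rw [divergence_smul_apply (differentiableAt_norm' hz) (hgradΦd z hz),
        divergence_gradient_eq_laplacian_of_contDiffAt (hΦ2 z hz), fderiv_norm_apply hz, real_inner_comm,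
        hEulerΦ z hz, mul_zero, add_zero]
    have hΔ : (Δ Φ) z = -2 * f z / ‖z‖ ^ 2 := by
      rw [← hP z hz]; field_simp
    rw [hdivsub, hdiv z hz, hdivA, hdivB, hΔ]
    field_simp
    ring
  -- (4) V is radially irrotational off the origin
  have hVrot : ∀ z : E3, z ≠ 0 → inner ℝ (curl V z) z = 0 := by
    intro z hz
    have hd1 : DifferentiableAt ℝ (fun w : E3 => (f w * ‖w‖⁻¹) • w) z := (hgd z hz).smul differentiableAt_id
    have hd2 : DifferentiableAt ℝ (fun w : E3 => ‖w‖ • gradient Φ w) z :=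
      (differentiableAt_norm' hz).smul (hgradΦd z hz)
    have hcurl : curl V z = curl U z - (curl (fun w : E3 => (f w * ‖w‖⁻¹) • w) z
        + curl (fun w : E3 => ‖w‖ • gradient Φ w) z) := by
      simp only [hVdef, hPdef]
      rw [curl_sub (hUd z hz) (hd1.fun_add hd2), curl_add hd1 hd2]
    have hsl : cross (‖z‖⁻¹ • z) (gradient Φ z) = ‖z‖⁻¹ • cross z (gradient Φ z) := by
      rw [← crossCLM_apply, ← crossCLM_apply, map_smul]; rfl
    rw [hcurl, PoloidalField.curl_smul_self (hgd z hz), OrderTwo.curl_smul_gradient (differentiableAt_norm' hz) (hΦ2 z hz),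
      gradient_norm hz, inner_sub_left, inner_add_left, hrot z hz, Tao2016.inner_cross_self_right, hsl,
      real_inner_smul_left, Tao2016.inner_cross_self_left]
    ring
  -- conclude with the rigidity lemma
  have hV0 := SphereRigidity.eq_zero hVC hVhom hVtan hVdiv hVrot hx
  simp only [hVdef, hPdef, sub_eq_zero] at hV0
  exact hV0

/-- **The order-one horizon law at the origin**: under the hypotheses of `profile_eq`,
`‖x‖ ⟪x, curl (U × curl U)(x)⟫ = −‖x‖ ⟪x, ∇f(x) × ∇Φ(x)⟫` for every `x ≠ 0`. -/
theorem horizonL1_origin (hU : ContDiffOn ℝ (⊤ : ℕ∞) U {0}ᶜ) (hΦ : ContDiffOn ℝ (⊤ : ℕ∞) Φ {0}ᶜ)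
    (hUhom : ∀ c : ℝ, 0 < c → ∀ y : E3, U (c • y) = U y) (hΦhom : ∀ c : ℝ, 0 < c → ∀ y : E3, Φ (c • y) = Φ y)
    (hdiv : ∀ x : E3, x ≠ 0 → VectorCalculus.divergence U x = 0)
    (hrot : ∀ x : E3, x ≠ 0 → inner ℝ (curl U x) x = 0)
    (hf : ∀ x : E3, x ≠ 0 → f x = inner ℝ (U x) x / ‖x‖)
    (hP : ∀ x : E3, x ≠ 0 → ‖x‖ ^ 2 * (Δ Φ) x = -2 * f x) {x : E3} (hx : x ≠ 0) :
    ‖x‖ * inner ℝ x (curl (fun z => cross (U z) (curl U z)) x)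
      = -‖x‖ * inner ℝ x (cross (gradient f x) (gradient Φ x)) := by
  have hopen : IsOpen ({0}ᶜ : Set E3) := isOpen_compl_singleton
  have hnx : ‖x‖ ≠ 0 := norm_ne_zero_iff.mpr hx
  -- regularity at `x`
  have hUx : ContDiffAt ℝ (⊤ : ℕ∞) U x := (hU x hx).contDiffAt (hopen.mem_nhds hx)
  have hU2 : ContDiffAt ℝ 2 U x := hUx.of_le (by norm_cast)
  have hUd : DifferentiableAt ℝ U x := hUx.differentiableAt (by simp)
  have hΩd : DifferentiableAt ℝ (curl U) x := by
    rw [curl_eq_curlCLM_comp]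
    exact curlCLM.differentiableAt.comp x
      ((hUx.fderiv_right (m := 1) (by norm_cast)).differentiableAt (by simp))
  have hΦx : ContDiffAt ℝ (⊤ : ℕ∞) Φ x := (hΦ x hx).contDiffAt (hopen.mem_nhds hx)
  have hΦ2 : ContDiffAt ℝ 2 Φ x := hΦx.of_le (by norm_cast)
  have hnormC : ContDiffOn ℝ (⊤ : ℕ∞) (fun w : E3 => ‖w‖) {0}ᶜ := fun z hz =>
    (contDiffAt_norm ℝ (show z ≠ 0 from hz)).contDiffWithinAt
  have hfC : ContDiffOn ℝ (⊤ : ℕ∞) f {0}ᶜ :=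
    ((hU.inner ℝ contDiffOn_id).div hnormC fun z hz => norm_ne_zero_iff.mpr hz).congr fun z hz => hf z hz
  have hfd : DifferentiableAt ℝ f x := ((hfC x hx).contDiffAt (hopen.mem_nhds hx)).differentiableAt (by simp)
  have hnd : DifferentiableAt ℝ (fun w : E3 => ‖w‖) x := differentiableAt_norm' hx
  have hnid : DifferentiableAt ℝ (fun w : E3 => ‖w‖⁻¹) x := hnd.inv hnx
  have hgd : DifferentiableAt ℝ (fun w : E3 => f w * ‖w‖⁻¹) x := hfd.mul hnid
  have hgradΦd : DifferentiableAt ℝ (gradient Φ) x := OrderTwo.differentiableAt_gradient hΦ2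
  -- tangency of `curl U` everywhere (junk-safe at the origin) and `div curl U = 0` at `x`
  have htan : ∀ z : E3, inner ℝ (curl U z) (z - 0) = 0 := by
    intro z; rw [sub_zero]
    by_cases hz : z = 0
    · rw [hz, inner_zero_right]
    · exact hrot z hz
  have hdivΩ : VectorCalculus.divergence (curl U) x = 0 :=
    HelicityDensityTransport.divergence_curl_eq_zero_of_contDiffAt hU2
  -- `⟪x, curl(U × Ω)⟫ = ⟪Ω, ∇m⟫`, `m = ⟪U, ·⟫ = f ‖·‖`
  have h1 := inner_curl_cross_of_tangent (x₀ := 0) hUd hΩd htan hdivΩ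
  have h2 := inner_gradient_inner_sub U 0 x hUd (curl U x)
  rw [sub_zero] at h1 h2
  have hm : (fun z : E3 => inner ℝ (U z) (z - 0)) =ᶠ[𝓝 x] fun z => f z * ‖z‖ := by
    filter_upwards [hopen.mem_nhds hx] with z hz
    rw [sub_zero, hf z hz, div_mul_cancel₀ _ (norm_ne_zero_iff.mpr hz)]
  have hgradm : gradient (fun z : E3 => inner ℝ (U z) (z - 0)) x = f x • (‖x‖⁻¹ • x) + ‖x‖ • gradient f x := by
    show (InnerProductSpace.toDual ℝ E3).symm (fderiv ℝ (fun z : E3 => inner ℝ (U z) (z - 0)) x) = _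
    rw [hm.fderiv_eq]
    change gradient (fun z : E3 => f z * ‖z‖) x = _
    rw [gradient_mul_apply hfd hnd, gradient_norm hx]
  -- `Ω = curl U (x)` from the decomposition `U = (f/r) y + r∇Φ` near `x`
  have hUP : U =ᶠ[𝓝 x] fun w => (f w * ‖w‖⁻¹) • w + ‖w‖ • gradient Φ w := by
    filter_upwards [hopen.mem_nhds hx] with z hz using profile_eq hU hΦ hUhom hΦhom hdiv hrot hf hP hz
  obtain ⟨β, hβ⟩ := gradient_norm_inv_radial hx
  have hsl : ∀ (κ : ℝ) (a b : E3), cross (κ • a) b = κ • cross a b := fun κ a b => by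
    rw [← crossCLM_apply, ← crossCLM_apply, map_smul]; rfl
  have hal : ∀ (a a' b : E3), cross (a + a') b = cross a b + cross a' b := fun a a' b => by
    rw [← crossCLM_apply, ← crossCLM_apply, ← crossCLM_apply, map_add]; rfl
  have hd1 : DifferentiableAt ℝ (fun w : E3 => (f w * ‖w‖⁻¹) • w) x := hgd.smul differentiableAt_id
  have hd2 : DifferentiableAt ℝ (fun w : E3 => ‖w‖ • gradient Φ w) x := hnd.smul hgradΦd
  have hΩ : curl U x = ‖x‖⁻¹ • cross (gradient f x) x + ‖x‖⁻¹ • cross x (gradient Φ x) := by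
    rw [curl_eq_curlCLM, hUP.fderiv_eq, ← curl_eq_curlCLM,
      curl_add hd1 hd2, PoloidalField.curl_smul_self hgd,
      OrderTwo.curl_smul_gradient hnd hΦ2, gradient_norm hx, gradient_mul_apply hfd hnid, hβ]
    simp only [hal, hsl, smul_smul, Tao2016.cross_self_eq_zero, smul_zero, zero_add]
  -- assemble
  rw [h1, ← h2, hgradm, inner_add_right, inner_smul_right, inner_smul_right, inner_smul_right, hrot x hx, mul_zero,
    mul_zero, zero_add, hΩ, inner_add_left, real_inner_smul_left, real_inner_smul_left,
    Tao2016.inner_cross_self_left, mul_zero, zero_add, real_inner_comm (gradient f x),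
    OrderTwo.inner_cross_cyclic (gradient f x) x (gradient Φ x)]
  have hanti : cross (gradient Φ x) (gradient f x) = -cross (gradient f x) (gradient Φ x) := by
    simp only [cross, ← cross_anticomm (WithLp.ofLp (gradient f x)) (WithLp.ofLp (gradient Φ x)), WithLp.toLp_neg]
  rw [hanti, inner_neg_right]
  field_simp

end SphereEuler

/-! ## `OrderOneSphereEuler` by name (translation to a general centre `x₀`) -/

/-- **ORDER-ONE HORIZON LAW = STEADY EULER ON THE SPHERE** (`HorizonTower.OrderOneSphereEuler`, Defs l.144, BY NAME):
for a smooth degree-0 homogeneous, divergence-free, unthreaded profile `U` about `x₀` with radial part `f = ⟪U, ξ⟫` and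
tangential potential `Φ` (`r²ΔΦ = −2f`), `𝔏₁[U](x) = −r ⟪y, ∇f × ∇Φ⟫` off `x₀`.  The hypotheses force `U = f ξ + r∇Φ`
(`SphereEuler.profile_eq`, through the sphere rigidity lemma `SphereRigidity.eq_zero`), after which the identity is the
order-one flux computation `⟪y, curl(U × Ω)⟫ = ⟪Ω, ∇(r f)⟫` with `Ω = (∇f × y + y × ∇Φ)/r`.
[cite: MajdaBertozziCUP2002, §1.1 (vector identities)] -/
theorem orderOneSphereEuler : OrderOneSphereEuler := by
  intro U f Φ x₀ hU hΦ hUhom hΦhom hdiv hrot hf hP x hx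
  -- translate to the origin
  set U₀ : E3 → E3 := fun y => U (x₀ + y) with hU₀
  set f₀ : E3 → ℝ := fun y => f (x₀ + y) with hf₀
  set Φ₀ : E3 → ℝ := fun y => Φ (x₀ + y) with hΦ₀
  have hne : ∀ y : E3, y ≠ 0 → x₀ + y ≠ x₀ := fun y hy h => hy (by simpa using h)
  have htr : ContDiff ℝ (⊤ : ℕ∞) (fun y : E3 => x₀ + y) := contDiff_const.add contDiff_id
  have hmaps : Set.MapsTo (fun y : E3 => x₀ + y) ({0}ᶜ : Set E3) ({x₀}ᶜ : Set E3) := fun y hy => hne y hy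
  have hU₀c : ContDiffOn ℝ (⊤ : ℕ∞) U₀ {0}ᶜ := hU.comp htr.contDiffOn hmaps
  have hΦ₀c : ContDiffOn ℝ (⊤ : ℕ∞) Φ₀ {0}ᶜ := hΦ.comp htr.contDiffOn hmaps
  have hfd₀ : ∀ y : E3, fderiv ℝ U₀ y = fderiv ℝ U (x₀ + y) := fun y => fderiv_comp_add_left x₀
  have hcurl₀ : ∀ y : E3, curl U₀ y = curl U (x₀ + y) := fun y => by
    rw [curl_eq_curlCLM, curl_eq_curlCLM, hfd₀]
  have hdiv₀ : ∀ y : E3, y ≠ 0 → VectorCalculus.divergence U₀ y = 0 := fun y hy => by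
    unfold VectorCalculus.divergence; rw [hfd₀]; exact hdiv _ (hne y hy)
  have hrot₀ : ∀ y : E3, y ≠ 0 → inner ℝ (curl U₀ y) y = 0 := fun y hy => by
    have h := hrot _ (hne y hy); rwa [add_sub_cancel_left, ← hcurl₀] at h
  have hf₀' : ∀ y : E3, y ≠ 0 → f₀ y = inner ℝ (U₀ y) y / ‖y‖ := fun y hy => by
    have h := hf _ (hne y hy); rwa [add_sub_cancel_left] at h
  have hΔ₀ : ∀ y : E3, (Δ Φ₀) y = (Δ Φ) (x₀ + y) := fun y => by
    rw [InnerProductSpace.laplacian_eq_iteratedFDeriv_orthonormalBasis Φ₀ (EuclideanSpace.basisFun (Fin 3) ℝ),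
      InnerProductSpace.laplacian_eq_iteratedFDeriv_orthonormalBasis Φ (EuclideanSpace.basisFun (Fin 3) ℝ)]
    simp only [hΦ₀, iteratedFDeriv_comp_add_left]
  have hP₀ : ∀ y : E3, y ≠ 0 → ‖y‖ ^ 2 * (Δ Φ₀) y = -2 * f₀ y := fun y hy => by
    have h := hP _ (hne y hy); rwa [add_sub_cancel_left, ← hΔ₀] at h
  have hUhom₀ : ∀ c : ℝ, 0 < c → ∀ y : E3, U₀ (c • y) = U₀ y := fun c hc y => hUhom c hc y
  have hgf : ∀ y : E3, gradient f₀ y = gradient f (x₀ + y) := fun y => by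
    show (InnerProductSpace.toDual ℝ E3).symm (fderiv ℝ f₀ y) = (InnerProductSpace.toDual ℝ E3).symm (fderiv ℝ f (x₀ + y))
    rw [hf₀, fderiv_comp_add_left]
  have hgΦ : ∀ y : E3, gradient Φ₀ y = gradient Φ (x₀ + y) := fun y => by
    show (InnerProductSpace.toDual ℝ E3).symm (fderiv ℝ Φ₀ y) = (InnerProductSpace.toDual ℝ E3).symm (fderiv ℝ Φ (x₀ + y))
    rw [hΦ₀, fderiv_comp_add_left]
  -- the Lamb field translates
  have hlamb : (fun w : E3 => cross (U₀ w) (curl U₀ w)) = fun w => (fun z => cross (U z) (curl U z)) (x₀ + w) :=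
    funext fun w => by rw [hcurl₀]
  have hcurlT : ∀ (W : E3 → E3) (y : E3), curl (fun z => W (x₀ + z)) y = curl W (x₀ + y) := fun W y => by
    rw [curl_eq_curlCLM, curl_eq_curlCLM, fderiv_comp_add_left]
  have hy : x - x₀ ≠ 0 := sub_ne_zero.mpr hx
  have key := SphereEuler.horizonL1_origin hU₀c hΦ₀c hUhom₀ hΦhom hdiv₀ hrot₀ hf₀' hP₀ hy
  have hcurlL : curl (fun w : E3 => cross (U₀ w) (curl U₀ w)) (x - x₀)
      = curl (fun z => cross (U z) (curl U z)) (x₀ + (x - x₀)) := by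
    rw [hlamb]; exact hcurlT (fun z => cross (U z) (curl U z)) (x - x₀)
  rw [hcurlL, hgf, hgΦ, add_sub_cancel] at key
  unfold horizonL1
  exact key



end Summit.NavierStokesRegularity.NavierStokesRegularity.Theorems.PoloidalLiouville.HorizonTower

end
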